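import Summits.QuantumFields.YangMills.Theorems.BalabanUVNodesN15PerCubeGreenSopInverse
import Literature.MathematicalPhysics.QuantumFieldTheory.Balaban1983to89.B9Eq3130MatrixLetters
import HarnessLib

/-!
# N15 = NE2, road (c) — PROGRAMME (PC), (PC-C): BAŁABAN's `R(U)` AND THE PROJECTION `I − R(U) = G′Q′ᵀ(Q′G′²Q′ᵀ)⁻¹Q′G′` DECAY FOR `U` IN THE PER-CUBE CLASS — the five factors' per-cube rows
# (n15-c∕266, n15-c∕202∕205, n15-c∕299e) composed at their scales (dag-n15-c g28, n15-c∕299g)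

Cell `pub-ymgap`, seat `pub-ymgap-dag-n15-c` (generation g28; R134 (a), s1; HUMAN RULING D-0062).  `bears_on: R4∕N15 · K3⁸ SpineGivenEndpointR13SepCoPHV (stmt-QuantumFields-27366)`;
filed `--kind proof --supports stmt-QuantumFields-27366 --as helper` — COUNT-NEUTRAL.  0 `def`, 0 `sorry`.  Imports n15-c∕299e `…PerCubeGreenSopInverse` (★★★★ `hasMaj_cSop_inv_of_reg335BigBox`;
through it n15-c∕266 `hasMaj_cGreen_of_reg335Box`, n15-c∕202∕205 `hasMaj_csavg(_transpose)`, n15-c∕298a `rows/cols_cvaStair_cvT_le`, FILE 119 nested boxes), lit `hasMaj_id_ofBlocks`.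
Nothing in the tree is modified.

WHY ([B9] (3.25) p.394: «Rf = (I − G′Q′*(Q′G′²Q′*)⁻¹Q′G′)f», Thm 3.2 (3.48) p.398: the exponential decay of `R(U)` for `U` in the class (3.35)).  The Landau letter `N_V^R = D_U(I − R(U))D*_U − flat`
of road (c) reads the projection `I − R(U)`; for `U` in the PRINTED per-cube class its decay is assembled from the five factors, each now with per-cube rows: `G′(U) ≤ B₆e^{−δd}` (n15-c∕266,
class on the two-collar boxes — implied by the walk-locality-box data, FILE 119), `Q′(U)ᵀ ≤ (L^k)^{−(d+1)}|ι|` and `Q′(U) ≤ |ι|` (block-diagonal, orthogonal staircase transports),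
`(Q′G′²Q′ᵀ)⁻¹(U) ≤ B(L^k)^{d+1}e^{−δd}` (n15-c∕299e): ★★★★ `hasMaj_cPi_of_reg335BigBox` — `mulVecLin (cPi (cvT e U) a_K) ≤ B′e^{−δ′d}` on the fine coloured scalars — and ★★★★
`hasMaj_cR_of_reg335BigBox` — `mulVecLin (cR (cvT e U) a_K) ≤ (1 + B′)e^{−δ′d}` (`R = 1 − (I − R)`), uniformly in `k`, under 299e's hypotheses.

HONEST FRAMING ∕ LIMITS.  MODEL carriers (n15-c∕262's cover, `L ≥ 11`, class asked on the walk-locality boxes); the SHAPE of (3.25) ∕ (3.48), NOT the printed theorem; no operator of record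
estimated.  NE2⁺ NOT PRINTED, NOT proved; N15 of record untouched; K3⁸ OPEN; counts UNMOVED.  Restate-immune (no Theses import).
-/

noncomputable section

open scoped BigOperators Matrix Matrix.Norms.L2Operator

namespace Summit.QuantumFields.YangMills.BalabanUVNodes.N15.Gluing

open Real
open Literature.MathematicalPhysics.QuantumFieldTheory.Balaban1983to89
open Literature.MathematicalPhysics.QuantumFieldTheory.Balaban1983to89.B5Prop11Plancherel (Tor fine unitVec)
open Literature.MathematicalPhysics.QuantumFieldTheory.Balaban1983to89.B11SectG (BlockNorm HasMaj RowSum)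
open Literature.MathematicalPhysics.QuantumFieldTheory.Balaban1983to89.B6RandomWalk (Triangle254)
open Literature.MathematicalPhysics.QuantumFieldTheory.Balaban1983to89.B6UnitTorusCarrier (unitTorusGeo triangle254_unitTorusGeo rowSum_unitTorusGeo unitTorusGeo_dist_nonneg unitTorusGeo_dist_self)
open Literature.MathematicalPhysics.QuantumFieldTheory.Balaban1983to89.B9Eq335RegularityClasses (Reg335Cube)
open Literature.MathematicalPhysics.QuantumFieldTheory.Balaban1983to89.B9Eq3117Current (gaugeTr)
open Literature.MathematicalPhysics.QuantumFieldTheory.Balaban1983to89.B9Eq39Adjoint (covD fluct)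
open Literature.MathematicalPhysics.QuantumFieldTheory.Balaban1983to89.B9Eq3130MatrixLetters (hasMaj_id_ofBlocks)
open Summit.QuantumFields.YangMills.BalabanUVNodes.N15.CovLandau (cSop cGreen csavg cPi cR hasMaj_csavg hasMaj_csavg_transpose mulVecLin_sub')
open Summit.QuantumFields.YangMills.BalabanUVNodes.N15.BackgroundModel (kappa_ofBlocks)
open Literature.MathematicalPhysics.QuantumFieldTheory.King1986 (aK)
open Literature.MathematicalPhysics.QuantumFieldTheory.King1986.Torus (blockOf)
open Literature.Barriers.QuantumFields (traceForm)
open Summit.QuantumFields.YangMills.BalabanUVNodes.N15.MatrixSpecies (basisConst liftBlk)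
open Summit.QuantumFields.YangMills.BalabanUVNodes.N15.TwoGrid (cubeBlocks hasMaj_smul_ofBlocks)
open Summit.QuantumFields.YangMills.BalabanUVNodes.N15.CurvedSpecies (uN_val_inv_eq_conjTranspose)

variable {d : ℕ}

section Projection

variable {L : ℕ} [NeZero L]

/-- the walk-locality box holds the two-collar box and fits in the torus (`L ≥ 11`): the three inequalities of FILE 119's nested-boxes lemma. [folklore] -/
theorem bigBox_fits {L : ℕ} (hL11 : 11 ≤ L) (mv : ℕ) :
    2 * L ^ mv + 1 ≤ L * L ^ mv + 3 * L ^ mv - 1 - coverMargin L mv ∧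
      (L * L ^ mv + 3 * L ^ mv - 1 - coverMargin L mv - (2 * L ^ mv + 1)) + (6 * L ^ mv + 3) ≤ L * L ^ mv + 10 * L ^ mv ∧
      L * L ^ mv + 10 * L ^ mv ≤ 2 * L * L ^ mv := by
  have hw1 : 1 ≤ L ^ mv := Nat.one_le_pow _ _ (by omega)
  have hLw : 11 * L ^ mv ≤ L * L ^ mv := Nat.mul_le_mul_right _ hL11
  have e2 : 2 * L * L ^ mv = 2 * (L * L ^ mv) := by ring
  have hm : 2 * coverMargin L mv + 2 * L ^ mv ≤ L * L ^ mv := by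
    unfold coverMargin
    have hLm : (L - 2) * L ^ mv = L * L ^ mv - 2 * L ^ mv := Nat.sub_mul L 2 (L ^ mv)
    omega
  generalize coverMargin L mv = m0 at hm ⊢
  generalize L * L ^ mv = Q at hLw e2 hm ⊢
  generalize L ^ mv = w at hw1 hLw hm e2 ⊢
  omega

/-- the walk-locality-box data give r06's class (3.35) on the two-collar box of every cut box (n15-c∕266's hypothesis): the two-collar box sits in the walk-locality box (FILE 119) and a
unitary gauge is of unitary type. [cite: Balaban1985BackgroundPropagators, (3.35) p.396 (shape)] -/
theorem reg335Cube_box2_of_bigBox (hL : Odd L ∧ 1 < L) (hL11 : 11 ≤ L) (mv kk : ℕ) {mm : Type} [Fintype mm] [DecidableEq mm] [Nonempty mm]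
    (U : Fin (d + 1) → ScX d L mv kk hL → (Matrix mm mm ℂ)ˣ) {ξ C : ℝ} (k : Fin (d + 1) → ZMod (2 * L))
    (h : ∃ (u : ScX d L mv kk hL → (Matrix mm mm ℂ)ˣ) (A : Fin (d + 1) → ScX d L mv kk hL → Matrix mm mm ℂ),
          (∀ x, (u x : Matrix mm mm ℂ) ∈ Matrix.unitaryGroup mm ℂ) ∧
          (∀ μ, ∀ z ∈ {x : ScX d L mv kk hL | blockOf (L ^ kk) (cvM d L mv kk hL) x ∈ cubeBlocks (cvM d L mv kk hL) (coverCorner (cvM d L mv kk hL) (L ^ mv) L (L * L ^ mv + 3 * L ^ mv - 1 - coverMargin L mv) k) (L * L ^ mv + 10 * L ^ mv)},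
              gaugeTr (scShift d L mv kk hL) u U μ z = fluct ((((L ^ kk : ℕ) : ℝ))⁻¹) A μ z) ∧
          (∀ μ, ∀ z ∈ {x : ScX d L mv kk hL | blockOf (L ^ kk) (cvM d L mv kk hL) x ∈ cubeBlocks (cvM d L mv kk hL) (coverCorner (cvM d L mv kk hL) (L ^ mv) L (L * L ^ mv + 3 * L ^ mv - 1 - coverMargin L mv) k) (L * L ^ mv + 10 * L ^ mv)},
              ‖A μ z‖ < C * ξ⁻¹) ∧
          (∀ μ ν, ∀ z ∈ {x : ScX d L mv kk hL | blockOf (L ^ kk) (cvM d L mv kk hL) x ∈ cubeBlocks (cvM d L mv kk hL) (coverCorner (cvM d L mv kk hL) (L ^ mv) L (L * L ^ mv + 3 * L ^ mv - 1 - coverMargin L mv) k) (L * L ^ mv + 10 * L ^ mv)},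
              ‖((↑((((L ^ kk : ℕ) : ℝ))⁻¹) : ℂ)⁻¹) • covD (scShift d L mv kk hL) (fun _ _ => (1 : (Matrix mm mm ℂ)ˣ)) μ (A ν) z‖ < C * (ξ ^ 2)⁻¹)) :
    Reg335Cube (scShift d L mv kk hL) U ((((L ^ kk : ℕ) : ℝ))⁻¹) {x : ScX d L mv kk hL | blockOf (L ^ kk) (cvM d L mv kk hL) x ∈ cubeBlocks (cvM d L mv kk hL) (coverCorner (cvM d L mv kk hL) (L ^ mv) L (2 * L ^ mv + 1) k) (6 * L ^ mv + 3)} ξ C := by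
  obtain ⟨u, A, hu, hg, hA, hD⟩ := h
  have hM : ∀ ν, cvM d L mv kk hL ν = 2 * L * L ^ mv := MP_succ_eq L mv kk hL
  have hsub : ∀ x : ScX d L mv kk hL, blockOf (L ^ kk) (cvM d L mv kk hL) x ∈ cubeBlocks (cvM d L mv kk hL) (coverCorner (cvM d L mv kk hL) (L ^ mv) L (2 * L ^ mv + 1) k) (6 * L ^ mv + 3) →
      blockOf (L ^ kk) (cvM d L mv kk hL) x ∈ cubeBlocks (cvM d L mv kk hL) (coverCorner (cvM d L mv kk hL) (L ^ mv) L (L * L ^ mv + 3 * L ^ mv - 1 - coverMargin L mv) k) (L * L ^ mv + 10 * L ^ mv) := fun x hx => by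
    obtain ⟨h1, h2, h3⟩ := bigBox_fits hL11 mv
    exact mem_cubeBlocks_of_mem_inner hM (by omega) h2 h3 hx
  have hu1 : ∀ x, ‖(u x : Matrix mm mm ℂ)‖ ≤ 1 ∧ ‖(((u x)⁻¹ : (Matrix mm mm ℂ)ˣ) : Matrix mm mm ℂ)‖ ≤ 1 := fun x =>
    ⟨(CStarRing.norm_of_mem_unitary (hu x)).le, by
      rw [uN_val_inv_eq_conjTranspose (hu x)]
      exact (CStarRing.norm_of_mem_unitary (Unitary.star_mem (hu x))).le⟩
  exact ⟨u, A, fun z _ => hu1 z, fun κ z hz => hg κ z (hsub z hz), fun κ z hz => hA κ z (hsub z hz), fun κ ν z hz => hD κ ν z (hsub z hz)⟩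

set_option maxHeartbeats 400000 in
/-- ★★★★ **THE PROJECTION `I − R(U) = G′Q′ᵀ(Q′G′²Q′ᵀ)⁻¹Q′G′` DECAYS FOR `U` IN THE PER-CUBE CLASS, UNIFORMLY IN `k`** (n15-c∕299e's hypotheses: a unitary gauge + (3.35) potential on the
walk-locality box of every cube, letters `r_V`, `σ(r_V) ≤ R₀`, `L^m ≥ w₀`): `mulVecLin (cPi (cvT e U) a_K) ≤ B·e^{−δ|y−y′|_T}` on the fine coloured scalars — the factors `G′` (n15-c∕266),
`(L^k)^{d+1}Q′ᵀ`, `(L^k)^{−(d+1)}(Q′G′²Q′ᵀ)⁻¹` (n15-c∕299e), `Q′`, `G′` composed by [B11] `hasMaj_comp_exp`.  MODEL carriers; the SHAPE of [B9] (3.25) ∕ (3.48).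
[cite: Balaban1985BackgroundPropagators, (3.25) p.394, Thm 3.2 (3.48) p.398, (3.35) p.396, (3.95)–(3.96) p.411 (shapes ∕ mechanism); Balaban1984PropagatorsI, (1.20) p.20] -/
theorem hasMaj_cPi_of_reg335BigBox (hL : Odd L ∧ 1 < L) (hL11 : 11 ≤ L) {a₀ : ℝ} (ha₀ : 0 < a₀) (ι : Type) [Fintype ι] [DecidableEq ι] :
    ∃ δ w₀ R₀ B : ℝ, 0 < δ ∧ 0 < R₀ ∧ 0 < B ∧
      ∀ (mv kk : ℕ), 1 ≤ kk → w₀ ≤ ((L ^ mv : ℕ) : ℝ) →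
      ∀ {mm : Type} [Fintype mm] [DecidableEq mm] [Nonempty mm] (e : Matrix mm mm ℂ ≃L[ℝ] (ι → ℝ)), (∀ A B : Matrix mm mm ℂ, traceForm A B = e A ⬝ᵥ e B) →
      ∀ (U : Fin (d + 1) → ScX d L mv kk hL → (Matrix mm mm ℂ)ˣ), (∀ μ x, (U μ x : Matrix mm mm ℂ) ∈ Matrix.unitaryGroup mm ℂ) →
      ∀ (ξ C : ℝ), 0 < ξ → 0 < C →
        (∀ k : Fin (d + 1) → ZMod (2 * L), ∃ (u : ScX d L mv kk hL → (Matrix mm mm ℂ)ˣ) (A : Fin (d + 1) → ScX d L mv kk hL → Matrix mm mm ℂ),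
          (∀ x, (u x : Matrix mm mm ℂ) ∈ Matrix.unitaryGroup mm ℂ) ∧
          (∀ μ, ∀ z ∈ {x : ScX d L mv kk hL | blockOf (L ^ kk) (cvM d L mv kk hL) x ∈ cubeBlocks (cvM d L mv kk hL) (coverCorner (cvM d L mv kk hL) (L ^ mv) L (L * L ^ mv + 3 * L ^ mv - 1 - coverMargin L mv) k) (L * L ^ mv + 10 * L ^ mv)},
              gaugeTr (scShift d L mv kk hL) u U μ z = fluct ((((L ^ kk : ℕ) : ℝ))⁻¹) A μ z) ∧
          (∀ μ, ∀ z ∈ {x : ScX d L mv kk hL | blockOf (L ^ kk) (cvM d L mv kk hL) x ∈ cubeBlocks (cvM d L mv kk hL) (coverCorner (cvM d L mv kk hL) (L ^ mv) L (L * L ^ mv + 3 * L ^ mv - 1 - coverMargin L mv) k) (L * L ^ mv + 10 * L ^ mv)},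
              ‖A μ z‖ < C * ξ⁻¹) ∧
          (∀ μ ν, ∀ z ∈ {x : ScX d L mv kk hL | blockOf (L ^ kk) (cvM d L mv kk hL) x ∈ cubeBlocks (cvM d L mv kk hL) (coverCorner (cvM d L mv kk hL) (L ^ mv) L (L * L ^ mv + 3 * L ^ mv - 1 - coverMargin L mv) k) (L * L ^ mv + 10 * L ^ mv)},
              ‖((↑((((L ^ kk : ℕ) : ℝ))⁻¹) : ℂ)⁻¹) • covD (scShift d L mv kk hL) (fun _ _ => (1 : (Matrix mm mm ℂ)ˣ)) μ (A ν) z‖ < C * (ξ ^ 2)⁻¹)) →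
      ∀ (rV : ℝ), 0 ≤ rV →
        Fintype.card ι * (@basisConst ι _ (Matrix mm mm ℂ) Matrix.frobeniusNormedAddCommGroup Matrix.frobeniusNormedSpace e * (2 * Real.sqrt (Fintype.card mm)) * (Real.sqrt (Fintype.card mm) * ((C / ξ) * Real.exp (((((L ^ kk : ℕ) : ℝ))⁻¹) * (C / ξ))))) ≤ rV →
        Fintype.card ι * (Fintype.card (Fin (d + 1)) * (Fintype.card ι * (@basisConst ι _ (Matrix mm mm ℂ) Matrix.frobeniusNormedAddCommGroup Matrix.frobeniusNormedSpace e * (2 * Real.sqrt (Fintype.card mm)) * (Real.sqrt (Fintype.card mm) * ((C / ξ) * Real.exp (((((L ^ kk : ℕ) : ℝ))⁻¹) * (C / ξ))))) ^ 2 + @basisConst ι _ (Matrix mm mm ℂ) Matrix.frobeniusNormedAddCommGroup Matrix.frobeniusNormedSpace e * (2 * Real.sqrt (Fintype.card mm)) * (Real.sqrt (Fintype.card mm) * ((C / ξ ^ 2) * Real.exp (((((L ^ kk : ℕ) : ℝ))⁻¹) * (C / ξ)))))) ≤ rV →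
        rV * (1 + Fintype.card (Fin (d + 1) ⊕ Fin (d + 1))) + a₀ * (Fintype.card ι * (Fintype.card ι * ((1 + rV * ((((L ^ kk : ℕ) : ℝ))⁻¹)) ^ ((d + 1) * L ^ kk) - 1) ^ 2 + 2 * ((1 + rV * ((((L ^ kk : ℕ) : ℝ))⁻¹)) ^ ((d + 1) * L ^ kk) - 1))) ≤ R₀ →
        ((1 + rV * ((((L ^ kk : ℕ) : ℝ))⁻¹)) ^ ((d + 1) * L ^ kk) - 1) ≤ R₀ →
        HasMaj (ScNorm d L mv kk hL ι) (ScNorm d L mv kk hL ι)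
            (Matrix.mulVecLin (cPi (cvM d L mv kk hL) (L ^ kk) (cvT e (fun μ x => (U μ x : Matrix mm mm ℂ))) (aK a₀ (L : ℝ) kk * (((L ^ kk : ℕ) : ℝ)) ^ (d + 1))))
          (fun y y' => B * Real.exp (-(δ * (unitTorusGeo L kk (cvM d L mv kk hL)).dist y y'))) := by
  classical
  have hL7 : 7 ≤ L := by omega
  obtain ⟨δ₆, w₆, R₆, B₆, hδ₆, hR₆, hB₆, H₆⟩ := hasMaj_cGreen_of_reg335Box (d := d) hL hL7 ha₀ ι
  obtain ⟨δS, wS, RS, BS, hδS, hRS, hBS, HS⟩ := hasMaj_cSop_inv_of_reg335BigBox (d := d) hL hL11 ha₀ ι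
  -- rates: common `δ₀`, row-sum rate `m = δ₀∕8`, four convolutions down to `δ₀ − 8m = 0`? — use `m = δ₀∕10`, final `δ₀∕5`
  set δ₀ : ℝ := min (δ₆ / 16) δS with hδ₀def
  have hδ₀ : 0 < δ₀ := lt_min (by positivity) hδS
  have hδ₀₆ : δ₀ ≤ δ₆ / 16 := min_le_left _ _
  have hδ₀S : δ₀ ≤ δS := min_le_right _ _
  set m : ℝ := δ₀ / 10 with hmdef
  have hm : 0 < m := by positivity
  set cr : ℝ := B4Sect5Proof.latticeConst (d + 1) m with hcrdef
  have hcr0 : 0 ≤ cr := B4Sect5Proof.latticeConst_nonneg (d + 1) hm.le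
  set τ : ℝ := (Fintype.card ι : ℝ) + 1 with hτdef
  have hτ0 : 0 ≤ τ := by positivity
  refine ⟨δ₀ - 8 * m, max w₆ wS, min R₆ RS, 1 * B₆ * (1 * τ * (1 * BS * (1 * τ * B₆ * cr) * cr) * cr) * cr + 1, by rw [hmdef]; linarith, lt_min hR₆ hRS, by positivity,
    fun mv kk hk hw₀ => ?_⟩
  intro mm _ _ _ e he U hU ξ C hξ hC hbig rV hrV hrA hrC hRle hσV
  have hw₆ : w₆ ≤ ((L ^ mv : ℕ) : ℝ) := (le_max_left _ _).trans hw₀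
  have hwS : wS ≤ ((L ^ mv : ℕ) : ℝ) := (le_max_right _ _).trans hw₀
  have hRle₆ := hRle.trans (min_le_left R₆ RS)
  have hRleS := hRle.trans (min_le_right R₆ RS)
  have hU' : ∀ μ x, ((U μ x : Matrix mm mm ℂ))ᴴ * (U μ x : Matrix mm mm ℂ) = 1 := fun μ x => Matrix.mem_unitaryGroup_iff'.mp (hU μ x)
  have htri : Triangle254 (unitTorusGeo L kk (cvM d L mv kk hL)) := triangle254_unitTorusGeo L kk _
  have hd : ∀ a b : Tor (cvM d L mv kk hL), 0 ≤ (unitTorusGeo L kk (cvM d L mv kk hL)).dist a b := unitTorusGeo_dist_nonneg L kk _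
  have hd0 : ∀ y : Tor (cvM d L mv kk hL), (unitTorusGeo L kk (cvM d L mv kk hL)).dist y y = 0 := unitTorusGeo_dist_self L kk _
  have hrow : RowSum (unitTorusGeo L kk (cvM d L mv kk hL)) m cr := by rw [hcrdef]; exact rowSum_unitTorusGeo L kk _ hm
  have hnpos : (0 : ℝ) < ((L ^ kk : ℕ) : ℝ) ^ (d + 1) := by positivity
  have hκF : (ScNorm d L mv kk hL ι).κ = 1 := kappa_ofBlocks _
  have hκC : (BlockNorm.ofBlocks (unitTorusGeo L kk (cvM d L mv kk hL)) (liftBlk (fun y : Tor (cvM d L mv kk hL) => y) ι)).κ = 1 := kappa_ofBlocks _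
  have hrate : ∀ ⦃c ρ ρ' : ℝ⦄, 0 ≤ c → ρ' ≤ ρ → ∀ y y' : Tor (cvM d L mv kk hL), c * Real.exp (-(ρ * (unitTorusGeo L kk (cvM d L mv kk hL)).dist y y')) ≤ c * Real.exp (-(ρ' * (unitTorusGeo L kk (cvM d L mv kk hL)).dist y y')) :=
    fun c ρ ρ' hc hρ y y' => mul_le_mul_of_nonneg_left (Real.exp_le_exp.mpr (by nlinarith only [hd y y', hρ])) hc
  -- the five factors
  have h335 := fun k => reg335Cube_box2_of_bigBox (d := d) hL hL11 mv kk U (ξ := ξ) (C := C) k (hbig k)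
  have hG : HasMaj (ScNorm d L mv kk hL ι) (ScNorm d L mv kk hL ι) (Matrix.mulVecLin (cGreen (cvM d L mv kk hL) (L ^ kk) (cvT e (fun μ x => (U μ x : Matrix mm mm ℂ))) (aK a₀ (L : ℝ) kk * (((L ^ kk : ℕ) : ℝ)) ^ (d + 1))))
      (fun y y' => B₆ * Real.exp (-(δ₀ * (unitTorusGeo L kk (cvM d L mv kk hL)).dist y y'))) :=
    (H₆ mv kk hk hw₆ e he U hU ξ C hξ hC.le h335 rV hrV hrA hrC hRle₆).mono (hrate (c := B₆) (ρ := δ₆ / 16) (ρ' := δ₀) hB₆.le hδ₀₆)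
  have hSi : HasMaj (BlockNorm.ofBlocks (unitTorusGeo L kk (cvM d L mv kk hL)) (liftBlk (fun y : Tor (cvM d L mv kk hL) => y) ι)) (BlockNorm.ofBlocks (unitTorusGeo L kk (cvM d L mv kk hL)) (liftBlk (fun y : Tor (cvM d L mv kk hL) => y) ι))
      ((((((L ^ kk : ℕ) : ℝ)) ^ (d + 1))⁻¹) • Matrix.mulVecLin (cSop (cvM d L mv kk hL) (L ^ kk) (cvT e (fun μ x => (U μ x : Matrix mm mm ℂ))) (aK a₀ (L : ℝ) kk * (((L ^ kk : ℕ) : ℝ)) ^ (d + 1)))⁻¹)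
      (fun y y' => BS * Real.exp (-(δ₀ * (unitTorusGeo L kk (cvM d L mv kk hL)).dist y y'))) := by
    have h := HS mv kk hk hwS e he U hU ξ C hξ hC hbig rV hrV hrA hrC hRleS (hσV.trans (min_le_right _ _))
    have h1 := hasMaj_smul_ofBlocks (g := unitTorusGeo L kk (cvM d L mv kk hL)) (liftBlk (fun y : Tor (cvM d L mv kk hL) => y) ι)
      (K := fun y y' => BS * (((L ^ kk : ℕ) : ℝ)) ^ (d + 1) * Real.exp (-(δS * (unitTorusGeo L kk (cvM d L mv kk hL)).dist y y'))) (fun y y' => by positivity) (((((L ^ kk : ℕ) : ℝ)) ^ (d + 1))⁻¹) h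
    refine h1.mono fun y y' => ?_
    rw [abs_of_pos (inv_pos.2 hnpos), show ((((L ^ kk : ℕ) : ℝ)) ^ (d + 1))⁻¹ * (BS * (((L ^ kk : ℕ) : ℝ)) ^ (d + 1) * Real.exp (-(δS * (unitTorusGeo L kk (cvM d L mv kk hL)).dist y y'))) = BS * Real.exp (-(δS * (unitTorusGeo L kk (cvM d L mv kk hL)).dist y y')) by field_simp]
    exact hrate (c := BS) (ρ := δS) (ρ' := δ₀) hBS.le hδ₀S y y'
  have hQ : HasMaj (ScNorm d L mv kk hL ι) (BlockNorm.ofBlocks (unitTorusGeo L kk (cvM d L mv kk hL)) (liftBlk (fun y : Tor (cvM d L mv kk hL) => y) ι))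
      (Matrix.mulVecLin (csavg (cvM d L mv kk hL) (L ^ kk) (cvT e (fun μ x => (U μ x : Matrix mm mm ℂ))))) (fun y y' => τ * Real.exp (-(δ₀ * (unitTorusGeo L kk (cvM d L mv kk hL)).dist y y'))) := by
    have h := hasMaj_csavg (cvM d L mv kk hL) (L ^ kk) L kk (cvT e (fun μ x => (U μ x : Matrix mm mm ℂ))) (τ := τ) hτ0 fun y a i =>
      (rows_cvaStair_cvT_le (cvM d L mv kk hL) (L ^ kk) e he hU' y a 0 i).trans (by rw [hτdef]; linarith only [])
    exact HasMaj.diag_const_exp δ₀ hd0 hτ0 h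
  have hR : HasMaj (BlockNorm.ofBlocks (unitTorusGeo L kk (cvM d L mv kk hL)) (liftBlk (fun y : Tor (cvM d L mv kk hL) => y) ι)) (ScNorm d L mv kk hL ι)
      ((((L ^ kk : ℕ) : ℝ)) ^ (d + 1) • Matrix.mulVecLin (csavg (cvM d L mv kk hL) (L ^ kk) (cvT e (fun μ x => (U μ x : Matrix mm mm ℂ))))ᵀ) (fun y y' => τ * Real.exp (-(δ₀ * (unitTorusGeo L kk (cvM d L mv kk hL)).dist y y'))) := by
    have h := hasMaj_csavg_transpose (cvM d L mv kk hL) (L ^ kk) L kk (cvT e (fun μ x => (U μ x : Matrix mm mm ℂ))) (τ := Fintype.card ι) (Nat.cast_nonneg _)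
      fun y a i => cols_cvaStair_cvT_le (cvM d L mv kk hL) (L ^ kk) e he hU' y a 0 i
    have h1 := hasMaj_smul_ofBlocks (g := unitTorusGeo L kk (cvM d L mv kk hL)) (liftBlk (scBlk d L mv kk hL) ι) (K := fun w w' => if w = w' then ((((L ^ kk : ℕ) : ℝ)) ^ (d + 1))⁻¹ * (Fintype.card ι : ℝ) else 0)
      (fun w w' => by split_ifs <;> positivity) ((((L ^ kk : ℕ) : ℝ)) ^ (d + 1)) h
    have h2 : HasMaj (BlockNorm.ofBlocks (unitTorusGeo L kk (cvM d L mv kk hL)) (liftBlk (fun y : Tor (cvM d L mv kk hL) => y) ι)) (ScNorm d L mv kk hL ι)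
        ((((L ^ kk : ℕ) : ℝ)) ^ (d + 1) • Matrix.mulVecLin (csavg (cvM d L mv kk hL) (L ^ kk) (cvT e (fun μ x => (U μ x : Matrix mm mm ℂ))))ᵀ) (fun w w' => if w = w' then τ else 0) := h1.mono fun w w' => by
      split_ifs
      · rw [abs_of_pos hnpos, ← mul_assoc, mul_inv_cancel₀ hnpos.ne', one_mul, hτdef]; linarith only []
      · rw [mul_zero]
    exact HasMaj.diag_const_exp δ₀ hd0 hτ0 h2
  -- the product `G (n^{d+1}Rᵀ) (n^{−(d+1)}S⁻¹) Q G`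
  set Gop := Matrix.mulVecLin (cGreen (cvM d L mv kk hL) (L ^ kk) (cvT e (fun μ x => (U μ x : Matrix mm mm ℂ))) (aK a₀ (L : ℝ) kk * (((L ^ kk : ℕ) : ℝ)) ^ (d + 1))) with hGop
  set Qop := Matrix.mulVecLin (csavg (cvM d L mv kk hL) (L ^ kk) (cvT e (fun μ x => (U μ x : Matrix mm mm ℂ)))) with hQop
  set Rop := (((((L ^ kk : ℕ) : ℝ)) ^ (d + 1)) • Matrix.mulVecLin (csavg (cvM d L mv kk hL) (L ^ kk) (cvT e (fun μ x => (U μ x : Matrix mm mm ℂ))))ᵀ) with hRop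
  set Sop := (((((L ^ kk : ℕ) : ℝ)) ^ (d + 1))⁻¹ • Matrix.mulVecLin (cSop (cvM d L mv kk hL) (L ^ kk) (cvT e (fun μ x => (U μ x : Matrix mm mm ℂ))) (aK a₀ (L : ℝ) kk * (((L ^ kk : ℕ) : ℝ)) ^ (d + 1)))⁻¹) with hSop
  have h1 : HasMaj (ScNorm d L mv kk hL ι) (BlockNorm.ofBlocks (unitTorusGeo L kk (cvM d L mv kk hL)) (liftBlk (fun y : Tor (cvM d L mv kk hL) => y) ι)) (Qop ∘ₗ Gop) (fun y y' => (ScNorm d L mv kk hL ι).κ * τ * B₆ * cr * Real.exp (-((δ₀ - 2 * m) * (unitTorusGeo L kk (cvM d L mv kk hL)).dist y y'))) :=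
    B11SectG.hasMaj_comp_exp htri hd hrow hτ0 hB₆.le (by rw [hmdef]; linarith) (by rw [hmdef]; linarith) (by rw [hmdef]; linarith) hQ hG
  have h2 : HasMaj (ScNorm d L mv kk hL ι) (BlockNorm.ofBlocks (unitTorusGeo L kk (cvM d L mv kk hL)) (liftBlk (fun y : Tor (cvM d L mv kk hL) => y) ι)) (Sop ∘ₗ (Qop ∘ₗ Gop)) (fun y y' => (BlockNorm.ofBlocks (unitTorusGeo L kk (cvM d L mv kk hL)) (liftBlk (fun y : Tor (cvM d L mv kk hL) => y) ι)).κ * BS * ((ScNorm d L mv kk hL ι).κ * τ * B₆ * cr) * cr * Real.exp (-((δ₀ - 4 * m) * (unitTorusGeo L kk (cvM d L mv kk hL)).dist y y'))) :=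
    B11SectG.hasMaj_comp_exp htri hd hrow hBS.le (by rw [hκF]; positivity) (by rw [hmdef]; linarith) (by rw [hmdef]; linarith) (by rw [hmdef]; linarith) hSi h1
  have h3 : HasMaj (ScNorm d L mv kk hL ι) (ScNorm d L mv kk hL ι) (Rop ∘ₗ (Sop ∘ₗ (Qop ∘ₗ Gop))) (fun y y' => (BlockNorm.ofBlocks (unitTorusGeo L kk (cvM d L mv kk hL)) (liftBlk (fun y : Tor (cvM d L mv kk hL) => y) ι)).κ * τ * ((BlockNorm.ofBlocks (unitTorusGeo L kk (cvM d L mv kk hL)) (liftBlk (fun y : Tor (cvM d L mv kk hL) => y) ι)).κ * BS * ((ScNorm d L mv kk hL ι).κ * τ * B₆ * cr) * cr) * cr * Real.exp (-((δ₀ - 6 * m) * (unitTorusGeo L kk (cvM d L mv kk hL)).dist y y'))) :=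
    B11SectG.hasMaj_comp_exp htri hd hrow hτ0 (by rw [hκF, hκC]; positivity) (by rw [hmdef]; linarith) (by rw [hmdef]; linarith) (by rw [hmdef]; linarith) hR h2
  have h4 : HasMaj (ScNorm d L mv kk hL ι) (ScNorm d L mv kk hL ι) (Gop ∘ₗ (Rop ∘ₗ (Sop ∘ₗ (Qop ∘ₗ Gop)))) (fun y y' => (ScNorm d L mv kk hL ι).κ * B₆ * ((BlockNorm.ofBlocks (unitTorusGeo L kk (cvM d L mv kk hL)) (liftBlk (fun y : Tor (cvM d L mv kk hL) => y) ι)).κ * τ * ((BlockNorm.ofBlocks (unitTorusGeo L kk (cvM d L mv kk hL)) (liftBlk (fun y : Tor (cvM d L mv kk hL) => y) ι)).κ * BS * ((ScNorm d L mv kk hL ι).κ * τ * B₆ * cr) * cr) * cr) * cr * Real.exp (-((δ₀ - 8 * m) * (unitTorusGeo L kk (cvM d L mv kk hL)).dist y y'))) :=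
    B11SectG.hasMaj_comp_exp htri hd hrow hB₆.le (by rw [hκF, hκC]; positivity) (by rw [hmdef]; linarith) (by rw [hmdef]; linarith) (by rw [hmdef]; linarith) hG h3
  -- `cPi` IS this product
  have hcPi : Matrix.mulVecLin (cPi (cvM d L mv kk hL) (L ^ kk) (cvT e (fun μ x => (U μ x : Matrix mm mm ℂ))) (aK a₀ (L : ℝ) kk * (((L ^ kk : ℕ) : ℝ)) ^ (d + 1))) =
      Gop ∘ₗ (Rop ∘ₗ (Sop ∘ₗ (Qop ∘ₗ Gop))) := by
    rw [hGop, hRop, hSop, hQop]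
    simp only [LinearMap.comp_smul, LinearMap.smul_comp, smul_smul, inv_mul_cancel₀ hnpos.ne', one_smul]
    rw [cPi, Matrix.mulVecLin_mul, Matrix.mulVecLin_mul, Matrix.mulVecLin_mul, Matrix.mulVecLin_mul]
    simp only [LinearMap.comp_assoc]
  rw [hcPi]
  refine h4.mono fun y y' => ?_
  rw [hκF, hκC]
  have hE := Real.exp_nonneg (-((δ₀ - 8 * m) * (unitTorusGeo L kk (cvM d L mv kk hL)).dist y y'))
  nlinarith only [hE]

/-- ★★★★ **BAŁABAN's `R(U) = 1 − (I − R(U))` DECAYS FOR `U` IN THE PER-CUBE CLASS**: `mulVecLin (cR (cvT e U) a_K) ≤ (1 + B)·e^{−δ|y−y′|_T}` under 299e's hypotheses (the identity has the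
diagonal majorant, lit `hasMaj_id_ofBlocks`).  MODEL carriers; the SHAPE of [B9] Thm 3.2 (3.48) for `R(U)`, NOT the printed theorem. [cite: Balaban1985BackgroundPropagators, (3.21) p.394, (3.25) p.394, Thm 3.2 (3.48) p.398 (shapes)] -/
theorem hasMaj_cR_of_reg335BigBox (hL : Odd L ∧ 1 < L) (hL11 : 11 ≤ L) {a₀ : ℝ} (ha₀ : 0 < a₀) (ι : Type) [Fintype ι] [DecidableEq ι] :
    ∃ δ w₀ R₀ B : ℝ, 0 < δ ∧ 0 < R₀ ∧ 0 < B ∧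
      ∀ (mv kk : ℕ), 1 ≤ kk → w₀ ≤ ((L ^ mv : ℕ) : ℝ) →
      ∀ {mm : Type} [Fintype mm] [DecidableEq mm] [Nonempty mm] (e : Matrix mm mm ℂ ≃L[ℝ] (ι → ℝ)), (∀ A B : Matrix mm mm ℂ, traceForm A B = e A ⬝ᵥ e B) →
      ∀ (U : Fin (d + 1) → ScX d L mv kk hL → (Matrix mm mm ℂ)ˣ), (∀ μ x, (U μ x : Matrix mm mm ℂ) ∈ Matrix.unitaryGroup mm ℂ) →
      ∀ (ξ C : ℝ), 0 < ξ → 0 < C →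
        (∀ k : Fin (d + 1) → ZMod (2 * L), ∃ (u : ScX d L mv kk hL → (Matrix mm mm ℂ)ˣ) (A : Fin (d + 1) → ScX d L mv kk hL → Matrix mm mm ℂ),
          (∀ x, (u x : Matrix mm mm ℂ) ∈ Matrix.unitaryGroup mm ℂ) ∧
          (∀ μ, ∀ z ∈ {x : ScX d L mv kk hL | blockOf (L ^ kk) (cvM d L mv kk hL) x ∈ cubeBlocks (cvM d L mv kk hL) (coverCorner (cvM d L mv kk hL) (L ^ mv) L (L * L ^ mv + 3 * L ^ mv - 1 - coverMargin L mv) k) (L * L ^ mv + 10 * L ^ mv)},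
              gaugeTr (scShift d L mv kk hL) u U μ z = fluct ((((L ^ kk : ℕ) : ℝ))⁻¹) A μ z) ∧
          (∀ μ, ∀ z ∈ {x : ScX d L mv kk hL | blockOf (L ^ kk) (cvM d L mv kk hL) x ∈ cubeBlocks (cvM d L mv kk hL) (coverCorner (cvM d L mv kk hL) (L ^ mv) L (L * L ^ mv + 3 * L ^ mv - 1 - coverMargin L mv) k) (L * L ^ mv + 10 * L ^ mv)},
              ‖A μ z‖ < C * ξ⁻¹) ∧
          (∀ μ ν, ∀ z ∈ {x : ScX d L mv kk hL | blockOf (L ^ kk) (cvM d L mv kk hL) x ∈ cubeBlocks (cvM d L mv kk hL) (coverCorner (cvM d L mv kk hL) (L ^ mv) L (L * L ^ mv + 3 * L ^ mv - 1 - coverMargin L mv) k) (L * L ^ mv + 10 * L ^ mv)},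
              ‖((↑((((L ^ kk : ℕ) : ℝ))⁻¹) : ℂ)⁻¹) • covD (scShift d L mv kk hL) (fun _ _ => (1 : (Matrix mm mm ℂ)ˣ)) μ (A ν) z‖ < C * (ξ ^ 2)⁻¹)) →
      ∀ (rV : ℝ), 0 ≤ rV →
        Fintype.card ι * (@basisConst ι _ (Matrix mm mm ℂ) Matrix.frobeniusNormedAddCommGroup Matrix.frobeniusNormedSpace e * (2 * Real.sqrt (Fintype.card mm)) * (Real.sqrt (Fintype.card mm) * ((C / ξ) * Real.exp (((((L ^ kk : ℕ) : ℝ))⁻¹) * (C / ξ))))) ≤ rV →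
        Fintype.card ι * (Fintype.card (Fin (d + 1)) * (Fintype.card ι * (@basisConst ι _ (Matrix mm mm ℂ) Matrix.frobeniusNormedAddCommGroup Matrix.frobeniusNormedSpace e * (2 * Real.sqrt (Fintype.card mm)) * (Real.sqrt (Fintype.card mm) * ((C / ξ) * Real.exp (((((L ^ kk : ℕ) : ℝ))⁻¹) * (C / ξ))))) ^ 2 + @basisConst ι _ (Matrix mm mm ℂ) Matrix.frobeniusNormedAddCommGroup Matrix.frobeniusNormedSpace e * (2 * Real.sqrt (Fintype.card mm)) * (Real.sqrt (Fintype.card mm) * ((C / ξ ^ 2) * Real.exp (((((L ^ kk : ℕ) : ℝ))⁻¹) * (C / ξ)))))) ≤ rV →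
        rV * (1 + Fintype.card (Fin (d + 1) ⊕ Fin (d + 1))) + a₀ * (Fintype.card ι * (Fintype.card ι * ((1 + rV * ((((L ^ kk : ℕ) : ℝ))⁻¹)) ^ ((d + 1) * L ^ kk) - 1) ^ 2 + 2 * ((1 + rV * ((((L ^ kk : ℕ) : ℝ))⁻¹)) ^ ((d + 1) * L ^ kk) - 1))) ≤ R₀ →
        ((1 + rV * ((((L ^ kk : ℕ) : ℝ))⁻¹)) ^ ((d + 1) * L ^ kk) - 1) ≤ R₀ →
        HasMaj (ScNorm d L mv kk hL ι) (ScNorm d L mv kk hL ι)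
            (Matrix.mulVecLin (cR (cvM d L mv kk hL) (L ^ kk) (cvT e (fun μ x => (U μ x : Matrix mm mm ℂ))) (aK a₀ (L : ℝ) kk * (((L ^ kk : ℕ) : ℝ)) ^ (d + 1))))
          (fun y y' => (1 + B) * Real.exp (-(δ * (unitTorusGeo L kk (cvM d L mv kk hL)).dist y y'))) := by
  obtain ⟨δ, w₀, R₀, B, hδ, hR₀, hB, H⟩ := hasMaj_cPi_of_reg335BigBox (d := d) hL hL11 ha₀ ι
  refine ⟨δ, w₀, R₀, B, hδ, hR₀, hB, fun mv kk hk hw₀ => ?_⟩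
  intro mm _ _ _ e he U hU ξ C hξ hC hbig rV hrV hrA hrC hRle hσV
  have hPi := H mv kk hk hw₀ e he U hU ξ C hξ hC hbig rV hrV hrA hrC hRle hσV
  have hd0 : ∀ y : Tor (cvM d L mv kk hL), (unitTorusGeo L kk (cvM d L mv kk hL)).dist y y = 0 := unitTorusGeo_dist_self L kk _
  have hid := hasMaj_id_ofBlocks (g := unitTorusGeo L kk (cvM d L mv kk hL)) (liftBlk (scBlk d L mv kk hL) ι) hd0 δ
  rw [cR, mulVecLin_sub', Matrix.mulVecLin_one]
  exact (hid.sub hPi).mono fun y y' => le_of_eq (by ring)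

end Projection

end Summit.QuantumFields.YangMills.BalabanUVNodes.N15.Gluing

end
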